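import Mathlib
import Summits.KontsevichZagierPeriods.Zeta5Search.LaiSavingCells
import HarnessLib

/-!
# Shard arithmetic for cell certificates: additivity, dyadic rate bounds, disjointness by chaining

Sub-problem `KontsevichZagierPeriods/Zeta5Search`, family `fam-indep` (linear independence /
dimension), generation 5. Systematic search; no irrationality claim unless certified.

A `Kappa3CellCert` (`LaiKappa3Cells.lean`) for the κ₃ point needs ≈ 10⁵ cells, spread over many tree
files ("shards"). Its per-cell field `adm` is decided shard by shard (`LaiSavingCheck.lean`,
`LaiSavingScan.lean`); this file supplies the generic list arithmetic for the three GLOBAL fields, none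
of which can be one `decide` over 10⁵ exact rationals:
* additivity over concatenation: `cellRateTrunc_append`, `cellRateUB_append`, `cellRateLBNat_append`,
  `cellRateUBNat_append`;
* `lo`: a computable NATURAL-NUMBER minorant `cellRateLBNat T K D` of `D · cellRateTrunc T K` (every term
  a `Nat` floor-division `⌊D (1/(k+u) − 1/(k+v))⌋ = D(bp − qa) / ((kb + a)(kq + p))` for `u = a/b`,
  `v = p/q`), `cellRateLBNat_le`, and `le_cellRateTrunc_of_LBNat : B·D ≤ cellRateLBNat T K D → B ≤
  cellRateTrunc T K`;
* `hi`: the matching majorant `cellRateUBNat T D` of `D · cellRateUB T` (floor-division plus one),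
  `cellRateUB_le_of_UBNat`;
* `disj`: `cellChain T` (consecutive cells satisfy `v_i ≤ u_{i+1}`, a linear-time Boolean) and
  `cellsDisjoint_of_cellChain : cellChain T = true → (∀ C ∈ T, C.WF lam = true) → CellsDisjoint T`.

HONEST FRAMING: bookkeeping lemmas over `List SavingCell`; no cell table is exhibited, no claim about
`ζ(5)` or about 'κ₃ ≤ 73' is made. References: [Zudilin2004] §8 p. 270 (the ψ-weights);
[Lai2024BallRivoal] arXiv:2407.14236, §4.
-/

open Finset

namespace Summit.KontsevichZagierPeriods.Zeta5Search

/-! ### Additivity over concatenation -/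

/-- `cellRateTrunc` is additive over `++`. [folklore] -/
theorem cellRateTrunc_append (T₁ T₂ : List SavingCell) (K : ℕ) :
    cellRateTrunc (T₁ ++ T₂) K = cellRateTrunc T₁ K + cellRateTrunc T₂ K := by
  simp [cellRateTrunc, List.map_append, List.sum_append]

/-- `cellRateUB` is additive over `++`. [folklore] -/
theorem cellRateUB_append (T₁ T₂ : List SavingCell) :
    cellRateUB (T₁ ++ T₂) = cellRateUB T₁ + cellRateUB T₂ := by
  simp [cellRateUB, List.map_append, List.sum_append]

/-- `cellExp` is additive over `++`. [folklore] -/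
theorem cellExp_append (T₁ T₂ : List SavingCell) (n p : ℕ) :
    cellExp (T₁ ++ T₂) n p = cellExp T₁ n p + cellExp T₂ n p := by
  simp [cellExp, List.map_append, List.sum_append]

/-! ### List-range sums (cheap kernel evaluation) versus `Finset.range` sums -/

/-- `((List.range K).map f).sum = Σ_{k<K} f k`. [folklore] -/
theorem list_range_map_sum_eq (f : ℕ → ℕ) (K : ℕ) :
    ((List.range K).map f).sum = ∑ k ∈ range K, f k := by
  induction K with
  | zero => simp
  | succ K ih => rw [List.range_succ, List.map_append, List.sum_append, ih, Finset.sum_range_succ]; simp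

/-! ### Numerator / denominator bookkeeping of a positive rational -/

/-- For `0 < u`: `u = u.num.toNat / u.den` in `ℚ`. [folklore] -/
theorem rat_eq_toNat_div_den {u : ℚ} (hu : 0 < u) : u = ((u.num.toNat : ℕ) : ℚ) / (u.den : ℕ) := by
  have h0 : 0 ≤ u.num := Rat.num_nonneg.2 hu.le
  have h1 : ((u.num.toNat : ℕ) : ℚ) = (u.num : ℚ) := by exact_mod_cast Int.toNat_of_nonneg h0
  rw [h1, Rat.num_div_den]

/-- For `0 < u`: `0 < u.num.toNat`. [folklore] -/
theorem toNat_num_pos {u : ℚ} (hu : 0 < u) : 0 < u.num.toNat := by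
  have : 0 < u.num := Rat.num_pos.2 hu
  omega

/-- `m / n < m ÷ n + 1` for natural floor division, read in `ℚ`. [folklore] -/
theorem rat_div_lt_natDiv_add_one (m n : ℕ) (hn : 0 < n) :
    (m : ℚ) / n < ((m / n : ℕ) : ℚ) + 1 := by
  have hn' : (0 : ℚ) < n := by exact_mod_cast hn
  rw [div_lt_iff₀ hn']
  have h := Nat.div_add_mod m n
  have hlt := Nat.mod_lt m hn
  have : (m : ℚ) = (n : ℚ) * ((m / n : ℕ) : ℚ) + ((m % n : ℕ) : ℚ) := by exact_mod_cast h.symm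
  rw [this]
  have hlt' : ((m % n : ℕ) : ℚ) < n := by exact_mod_cast hlt
  nlinarith

namespace SavingCell

/-! ### The dyadic (natural-number) minorant of the truncated density -/

/-- `⌊D (1/(k+u) − 1/(k+v))⌋` for `k < K`, summed: with `u = a/b`, `v = p/q` in lowest terms the `k`-th term
is the natural floor-division `D (b p − q a) / ((k b + a)(k q + p))`. [folklore] -/
def densityLBNat (C : SavingCell) (K D : ℕ) : ℕ :=
  ((List.range K).map fun k => D * (C.u.den * C.v.num.toNat - C.v.den * C.u.num.toNat) /
    ((k * C.u.den + C.u.num.toNat) * (k * C.v.den + C.v.num.toNat))).sum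

/-- The exact value of one weight term in numerator/denominator form. [folklore] -/
theorem density_term_eq (C : SavingCell) (hu : 0 < C.u) (huv : C.u ≤ C.v) (k : ℕ) :
    (1 / ((k : ℚ) + C.u) - 1 / ((k : ℚ) + C.v)) =
      ((C.u.den * C.v.num.toNat - C.v.den * C.u.num.toNat : ℕ) : ℚ) /
        (((k * C.u.den + C.u.num.toNat) * (k * C.v.den + C.v.num.toNat) : ℕ) : ℚ) := by
  have hv : 0 < C.v := lt_of_lt_of_le hu huv
  set a := C.u.num.toNat with ha
  set b := C.u.den with hb
  set p := C.v.num.toNat with hp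
  set q := C.v.den with hq
  have hua : C.u = (a : ℚ) / b := rat_eq_toNat_div_den hu
  have hvp : C.v = (p : ℚ) / q := rat_eq_toNat_div_den hv
  have hb0 : (0 : ℚ) < b := by exact_mod_cast C.u.den_pos
  have hq0 : (0 : ℚ) < q := by exact_mod_cast C.v.den_pos
  have ha0 : (0 : ℚ) < a := by exact_mod_cast toNat_num_pos hu
  have hp0 : (0 : ℚ) < p := by exact_mod_cast toNat_num_pos hv
  have hle : q * a ≤ b * p := by
    have h1 : (a : ℚ) / b ≤ (p : ℚ) / q := by rw [← hua, ← hvp]; exact huv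
    rw [div_le_div_iff₀ hb0 hq0] at h1
    have h2 : ((q * a : ℕ) : ℚ) ≤ ((b * p : ℕ) : ℚ) := by push_cast; linarith
    exact_mod_cast h2
  rw [Nat.cast_sub hle, hua, hvp]
  push_cast
  have hk : (0 : ℚ) ≤ k := by positivity
  field_simp
  ring

/-- Soundness: `densityLBNat C K D ≤ D · densityTrunc C K` (for `0 < u ≤ v`). [folklore] -/
theorem densityLBNat_le (C : SavingCell) (hu : 0 < C.u) (huv : C.u ≤ C.v) (K D : ℕ) :
    ((C.densityLBNat K D : ℕ) : ℚ) ≤ (D : ℚ) * C.densityTrunc K := by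
  rw [densityLBNat, list_range_map_sum_eq, densityTrunc, Nat.cast_sum, Finset.mul_sum]
  refine Finset.sum_le_sum fun k _ => ?_
  rw [density_term_eq C hu huv k]
  refine (Nat.cast_div_le).trans ?_
  rw [Nat.cast_mul, mul_div_assoc]

/-! ### The natural-number majorant of the density upper bound -/

/-- `⌊D (v − u)(1/u² + 2)⌋ + 1` as a natural floor-division plus one: with `u = a/b`, `v = p/q`,
`(v − u)(1/u² + 2) = (b p − q a)(b² + 2a²) / (b q a²)`. [folklore] -/
def densityUBNat (C : SavingCell) (D : ℕ) : ℕ :=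
  D * ((C.u.den * C.v.num.toNat - C.v.den * C.u.num.toNat) * (C.u.den ^ 2 + 2 * C.u.num.toNat ^ 2)) /
      (C.u.den * C.v.den * C.u.num.toNat ^ 2) + 1

/-- Soundness: `D · densityUB C ≤ densityUBNat C D` (for `0 < u ≤ v`). [folklore] -/
theorem mul_densityUB_le (C : SavingCell) (hu : 0 < C.u) (huv : C.u ≤ C.v) (D : ℕ) :
    (D : ℚ) * C.densityUB ≤ ((C.densityUBNat D : ℕ) : ℚ) := by
  have hv : 0 < C.v := lt_of_lt_of_le hu huv
  set a := C.u.num.toNat with ha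
  set b := C.u.den with hb
  set p := C.v.num.toNat with hp
  set q := C.v.den with hq
  have hua : C.u = (a : ℚ) / b := rat_eq_toNat_div_den hu
  have hvp : C.v = (p : ℚ) / q := rat_eq_toNat_div_den hv
  have hb0 : (0 : ℚ) < b := by exact_mod_cast C.u.den_pos
  have hq0 : (0 : ℚ) < q := by exact_mod_cast C.v.den_pos
  have ha0 : (0 : ℚ) < a := by exact_mod_cast toNat_num_pos hu
  have hle : q * a ≤ b * p := by
    have h1 : (a : ℚ) / b ≤ (p : ℚ) / q := by rw [← hua, ← hvp]; exact huv
    rw [div_le_div_iff₀ hb0 hq0] at h1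
    have h2 : ((q * a : ℕ) : ℚ) ≤ ((b * p : ℕ) : ℚ) := by push_cast; linarith
    exact_mod_cast h2
  have hden : 0 < b * q * a ^ 2 := by
    have := C.u.den_pos; have := C.v.den_pos; have := toNat_num_pos hu; positivity
  have key : (D : ℚ) * C.densityUB =
      ((D * ((b * p - q * a) * (b ^ 2 + 2 * a ^ 2)) : ℕ) : ℚ) / ((b * q * a ^ 2 : ℕ) : ℚ) := by
    rw [densityUB, Nat.cast_mul, Nat.cast_mul, Nat.cast_sub hle, hua, hvp]
    push_cast
    field_simp
  rw [key, densityUBNat, Nat.cast_add, Nat.cast_one]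
  exact (rat_div_lt_natDiv_add_one _ _ hden).le

end SavingCell

/-! ### Table versions and the two global fields -/

/-- Natural-number minorant of `D · cellRateTrunc T K`. [folklore] -/
def cellRateLBNat (T : List SavingCell) (K D : ℕ) : ℕ :=
  (T.map fun C => C.c * C.densityLBNat K D).sum

/-- Natural-number majorant of `D · cellRateUB T`. [folklore] -/
def cellRateUBNat (T : List SavingCell) (D : ℕ) : ℕ :=
  (T.map fun C => C.c * C.densityUBNat D).sum

/-- `cellRateLBNat` is additive over `++`. [folklore] -/
theorem cellRateLBNat_append (T₁ T₂ : List SavingCell) (K D : ℕ) :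
    cellRateLBNat (T₁ ++ T₂) K D = cellRateLBNat T₁ K D + cellRateLBNat T₂ K D := by
  simp [cellRateLBNat, List.map_append, List.sum_append]

/-- `cellRateUBNat` is additive over `++`. [folklore] -/
theorem cellRateUBNat_append (T₁ T₂ : List SavingCell) (D : ℕ) :
    cellRateUBNat (T₁ ++ T₂) D = cellRateUBNat T₁ D + cellRateUBNat T₂ D := by
  simp [cellRateUBNat, List.map_append, List.sum_append]

/-- Soundness of the table minorant: `cellRateLBNat T K D ≤ D · cellRateTrunc T K` for well-formed
cells. [folklore] -/
theorem cellRateLBNat_le (T : List SavingCell) {lam : ℕ} (hlam : 0 < lam)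
    (hT : ∀ C ∈ T, C.WF lam = true) (K D : ℕ) :
    ((cellRateLBNat T K D : ℕ) : ℚ) ≤ (D : ℚ) * cellRateTrunc T K := by
  induction T with
  | nil => simp [cellRateLBNat, cellRateTrunc]
  | cons C T ih =>
    obtain ⟨hu0, huv, _⟩ := (SavingCell.wf_iff _ _).1 (hT C (by simp))
    have hu : 0 < C.u := lt_of_lt_of_le (by positivity) hu0
    have ih' := ih fun C' hC' => hT C' (List.mem_cons_of_mem _ hC')
    simp only [cellRateLBNat, cellRateTrunc, List.map_cons, List.sum_cons, Nat.cast_add, Nat.cast_mul,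
      mul_add] at ih' ⊢
    have h1 := SavingCell.densityLBNat_le C hu huv.le K D
    have hc : (0 : ℚ) ≤ C.c := by positivity
    have := mul_le_mul_of_nonneg_left h1 hc
    nlinarith [this, ih']

/-- **The `lo` field from shard data**: `B · D ≤ cellRateLBNat T K D ⟹ B ≤ cellRateTrunc T K`.
[folklore] -/
theorem le_cellRateTrunc_of_LBNat (T : List SavingCell) {lam : ℕ} (hlam : 0 < lam)
    (hT : ∀ C ∈ T, C.WF lam = true) (K D B : ℕ) (hD : 0 < D) (h : B * D ≤ cellRateLBNat T K D) :
    (B : ℚ) ≤ cellRateTrunc T K := by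
  have h1 : ((B * D : ℕ) : ℚ) ≤ ((cellRateLBNat T K D : ℕ) : ℚ) := by exact_mod_cast h
  have h2 := cellRateLBNat_le T hlam hT K D
  have hD' : (0 : ℚ) < D := by exact_mod_cast hD
  rw [Nat.cast_mul] at h1
  nlinarith

/-- Soundness of the table majorant: `D · cellRateUB T ≤ cellRateUBNat T D` for well-formed cells.
[folklore] -/
theorem mul_cellRateUB_le (T : List SavingCell) {lam : ℕ} (hlam : 0 < lam)
    (hT : ∀ C ∈ T, C.WF lam = true) (D : ℕ) :
    (D : ℚ) * cellRateUB T ≤ ((cellRateUBNat T D : ℕ) : ℚ) := by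
  induction T with
  | nil => simp [cellRateUBNat, cellRateUB]
  | cons C T ih =>
    obtain ⟨hu0, huv, _⟩ := (SavingCell.wf_iff _ _).1 (hT C (by simp))
    have hu : 0 < C.u := lt_of_lt_of_le (by positivity) hu0
    have ih' := ih fun C' hC' => hT C' (List.mem_cons_of_mem _ hC')
    simp only [cellRateUBNat, cellRateUB, List.map_cons, List.sum_cons, Nat.cast_add, Nat.cast_mul,
      mul_add] at ih' ⊢
    have h1 := SavingCell.mul_densityUB_le C hu huv.le D
    have hc : (0 : ℚ) ≤ C.c := by positivity
    have := mul_le_mul_of_nonneg_left h1 hc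
    nlinarith [this, ih']

/-- **The `hi` field from shard data**: `cellRateUBNat T D ≤ B · D ⟹ cellRateUB T ≤ B`. [folklore] -/
theorem cellRateUB_le_of_UBNat (T : List SavingCell) {lam : ℕ} (hlam : 0 < lam)
    (hT : ∀ C ∈ T, C.WF lam = true) (D B : ℕ) (hD : 0 < D) (h : cellRateUBNat T D ≤ B * D) :
    cellRateUB T ≤ (B : ℚ) := by
  have h1 : ((cellRateUBNat T D : ℕ) : ℚ) ≤ ((B * D : ℕ) : ℚ) := by exact_mod_cast h
  have h2 := mul_cellRateUB_le T hlam hT D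
  have hD' : (0 : ℚ) < D := by exact_mod_cast hD
  rw [Nat.cast_mul] at h1
  nlinarith

/-! ### Disjointness by chaining -/

/-- Consecutive cells abut or leave a gap: `v_i ≤ u_{i+1}` (linear-time Boolean). [folklore] -/
def cellChain : List SavingCell → Bool
  | [] => true
  | [_] => true
  | C :: D :: rest => decide (C.v ≤ D.u) && cellChain (D :: rest)

/-- `cellChain` of a cons gives `cellChain` of the tail. [folklore] -/
theorem cellChain_tail {C : SavingCell} {rest : List SavingCell} (h : cellChain (C :: rest) = true) :
    cellChain rest = true := by
  cases rest with
  | nil => rfl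
  | cons D rest' =>
    simp only [cellChain, Bool.and_eq_true, decide_eq_true_eq] at h
    exact h.2

/-- In a chained list of non-empty cells the head ends before every later cell starts. [folklore] -/
theorem cellChain_head_le : ∀ (C : SavingCell) (rest : List SavingCell), cellChain (C :: rest) = true →
    (∀ D ∈ rest, D.u < D.v) → ∀ C' ∈ rest, C.v ≤ C'.u
  | C, [], _, _ => by simp
  | C, D :: rest, h, hwf => by
      simp only [cellChain, Bool.and_eq_true, decide_eq_true_eq] at h
      intro C' hC'
      rcases List.mem_cons.1 hC' with rfl | hmem
      · exact h.1
      · have h2 := cellChain_head_le D rest h.2 (fun E hE => hwf E (List.mem_cons_of_mem _ hE)) C' hmem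
        have hD := hwf D (by simp)
        linarith [h.1]

/-- **The `disj` field from chaining**: a chained list of well-formed cells is pairwise disjoint.
[folklore] -/
theorem cellsDisjoint_of_cellChain : ∀ (T : List SavingCell) {lam : ℕ}, cellChain T = true →
    (∀ C ∈ T, C.WF lam = true) → CellsDisjoint T
  | [], _, _, _ => List.Pairwise.nil
  | C :: rest, lam, h, hwf => by
      have hwf' : ∀ D ∈ C :: rest, D.u < D.v := fun D hD => ((SavingCell.wf_iff lam D).1 (hwf D hD)).2.1
      rw [CellsDisjoint, List.pairwise_cons]
      refine ⟨fun C' hC' t ht => ?_, ?_⟩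
      · have hle := cellChain_head_le C rest h (fun D hD => hwf' D (List.mem_cons_of_mem _ hD)) C' hC'
        linarith [ht.1.2, ht.2.1]
      · exact cellsDisjoint_of_cellChain rest (cellChain_tail h) fun D hD => hwf D (List.mem_cons_of_mem _ hD)

/-- `cellChain` over a concatenation from the two halves and the seam. [folklore] -/
theorem cellChain_append : ∀ (T₁ T₂ : List SavingCell), cellChain T₁ = true → cellChain T₂ = true →
    (∀ C ∈ T₁.getLast?, ∀ D ∈ T₂.head?, C.v ≤ D.u) → cellChain (T₁ ++ T₂) = true
  | [], T₂, _, h₂, _ => by simpa using h₂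
  | [C], [], _, _, _ => rfl
  | [C], D :: rest, _, h₂, hs => by
      have hCD : C.v ≤ D.u := hs C (by simp) D (by simp)
      simp only [List.singleton_append, cellChain, Bool.and_eq_true, decide_eq_true_eq]
      exact ⟨hCD, h₂⟩
  | C :: C' :: rest, T₂, h₁, h₂, hs => by
      simp only [cellChain, Bool.and_eq_true, decide_eq_true_eq] at h₁
      have ih := cellChain_append (C' :: rest) T₂ h₁.2 h₂ (by
        intro E hE F hF
        refine hs E ?_ F hF
        rw [List.getLast?_cons_cons]; exact hE)
      simp only [List.cons_append, cellChain, Bool.and_eq_true, decide_eq_true_eq] at ih ⊢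
      exact ⟨h₁.1, ih⟩

/-! ### Sanity checks (tiny instances, `decide`) -/

/-- Two abutting cells `[1/3, 1/2)`, `[1/2, 1)` chain. -/
example : cellChain [⟨1/3, 1/2, 7⟩, ⟨1/2, 1, 9⟩] = true := by decide +kernel

/-- The minorant of `[1/3, 1/2)` with `K = 3`, `D = 1000`: `⌊1000(3 − 2)⌋ + ⌊1000(3/4 − 2/3)⌋ +
⌊1000(3/7 − 2/5)⌋ = 1000 + 83 + 28`. -/
example : SavingCell.densityLBNat ⟨1/3, 1/2, 7⟩ 3 1000 = 1111 := by decide +kernel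

end Summit.KontsevichZagierPeriods.Zeta5Search
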